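import Summits.QuantumFields.YangMills.Theses.HyperbolicRegulator
import Summits.QuantumFields.YangMills.Theorems.HyperbolicRegulatorCurvatureUniformityRSplit
import Summits.QuantumFields.YangMills.Theorems.CurvatureUniformityR.Negative.ConeChartsOfAdmissibleFalse

/-!
# Disproof of `CurvatureUniformityR` — findings

Crux `Summit.QuantumFields.YangMills.Theses.HyperbolicRegulator.CurvatureUniformityR` (stmt-QuantumFields-18154), route
`HyperbolicRegulator`; disprover `refuter-cdisprove-stmt-QuantumFields-18154-0`, cycle 1 (2026-08-17).

## Findings (index)

1. **No unconditional kill of the crux is available in this tree, and none is expected cheaply.**  The crux quantifies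
   `∀ G, IsCompactSimpleLieGroup G → ∀ r : LatticeRep G, …`; `IsCompactSimpleLieGroup G := IsSimpleCompactGroup G ∧
   Nonempty (LatticeRep G)` has NO constructible inhabitant here (`isCompactSimpleLieGroup_specialUnitaryGroup` is conditional
   on the unproved Literature fact `isSimpleCompactGroup_specialUnitaryGroup`), so every `¬`-statement about the crux or about
   the `G`-carrying stubs (`stub_far`, `stub_meanInfluence`, `stub_chartDLR`, …) is at best a negative lemma modulo that fact —
   and would in addition need rigorous LOWER bounds on genuine `SU(N)` Wilson covariances on exotic cores (finite-temperature /
   deconfinement physics), which nobody can supply.  Junk choices inside the statement do not help: `E = ∅` or locally finite-range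
   families make every covariance vanish beyond finite distance (conclusion TRUE); constant / one-edge chart read-outs violate
   the anchor and the conclusion together.
2. **Load-bearing hypotheses.**  (i) The ANCHOR (rate `c/k` for `β ≥ β₀(k)`) is unusable toward the conclusion at fixed `β`
   (it covers only the finitely many `k` with `β₀(k) ≤ β`), so a proof must produce uniform clustering from scratch at fixed
   large `β`, `k → ∞` — the anchor is decoration for the prover, but dropping it does not make the crux refutable either (1).
   (ii) Clause (9) charts only FLAT points (`dist > k/2` to every cone) and clauses (3)–(8) are blind to the local topology
   within `k/2` of a cone: the typed family class is far larger than the `{4,5}_k`-modelled hyperbolic surfaces the thesis means.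
   Certified instance: the landed witness `X₈` (finding 3) is admissible at `k = 8`, `j = 0` with cone links `C₂ ⊔ C₃`
   (pinch points of positively curved sheets).  The same blindness admits "periscope" cores (strategist census N1′): films of
   `k`-independent circumference hidden inside the uncharted cone islands — the physics reason the crux AS TYPED is believed false
   for `SU(2)` (finite-temperature deconfinement, barrier `Literature.Barriers.QuantumFields.FiniteTemperatureDeconfinement`),
   not certifiable in Lean.  (iii) Clauses (5) `k`-density and (6) `k`-separation of cones only constrain the cone PATTERN, not
   what sits at a cone; (7) Poincaré `10⁶k²` is generous (`X₈`: `|V|·depth² = 45 936 ≪ 6.4·10⁷`) and does not exclude small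
   handles or pinches; (8) with `j` large forces diameter `≥ j` — satisfiable by chaining copies of any admissible block.
3. **Targets — line `cone_tame_window_transfer` (registered, not picked).**  `stub_coneCharts : ConeChartsOfAdmissible` is
   FALSE: `Negative.coneChartsOfAdmissible_false` (p173245, computational, this seat; restated below by name).  Together with
   `stub_sparseIslands` refuted earlier (p169554) the line is dead as filed; its honest content is the sibling
   `ConeTameSplit.TameCoreUniformityR` (cone charts as DATA = restate advice R-b), which the witness does not touch.
   **Classification for planners: the crux is misstated at the family-class level; repaired statement C′ :=
   `ConeTameSplit.TameCoreUniformityR`** (and, if the far regime is to be kept, only on cone-charted families).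
4. **Targets — picked line `Sketch` (`single-chart-markov`, `Lines/Sketch.lean`).**  `stub_chartInterior :
   ChartInteriorStructure` is `G`-free and TRUE (proof sketch: (E0) from clause (9) — equal edge ids give equal endpoint sets,
   chart injectivity on the box excludes the swapped case since `e_μ + e_μ' ≠ 0`; (E1) the four chart edges at an interior
   chart vertex are distinct by (E0) and the vertex has degree 4, being within chart distance `< k/2` of the flat base point
   hence not a cone — the tree's `card_edgesAt_ne_five_of_boxChart`; (E2) the two flanking chart squares exist by (9e), are
   distinct by (E0), and clause (3) says exactly two squares contain the edge).  Not a disprover target.  `stub_sumMatch`,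
   `stub_transfer`, `stub_chartDLR`, `stub_localOfMeanInfluence` are identities/glue believed provable.  `stub_meanInfluence`
   is the K-leaf (open).  `stub_far : CurvatureUniformityFarR` is UNCONSUMED by anything but the final composition, carries the
   whole far regime on the wild family class, and is believed false for the reason in 2(ii) — but see 1: no Lean attack exists;
   recommendation to the lead/planner: do not spend prover time on `stub_far`; restate the crux to cone-charted (tame) families
   first, where FAR becomes the genuine infrared statement.
5. **Reusable obstruction (checked below, `G`-free).**  `cc_link_hamiltonian`: the cone-chart clause `CC` at a cone `c`
   forces five distinct neighbours `n_s = cK c s (1,0)` of `c` with consecutive ones on a common square — a Hamiltonian 5-cycle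
   in the "common square through `c`" relation.  Any admissible complex with a cone whose link is not a 5-cycle (pinches
   `C₂ ⊔ C₃`, `C₁ ⊔ C₄`-type identifications, a cone of cone-angle `5·(π/2)` realised as a branched double point, …) therefore
   refutes every statement of the shape "admissible ⇒ cone charts exist"; future stubs must carry cone charts as data.

## What was tried (one line each)
unconditional `¬ crux` (blocked, finding 1) · junk families / junk read-outs (conclusion true or anchor co-fails) ·
`_false_without_` anchor/(5)/(6)/(7)/(8) (each needs `SU(N)` covariance control) · flat bands of circumference `≍ k/2`
(defused by eventual-in-`k` typing) · thin tubes / disc caps without pinches (Gauss–Bonnet bookkeeping forbids) · rectangular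
hole mouths (corner cones closer than `k`, violates (6)) · doubles of flat cone discs (convex corners `2k` from cones, violates
(5)) · **pinched hemicube ⊔ pillow `X₈` (WORKS against `ConeChartsOfAdmissible`; landed)**.
-/

set_option autoImplicit false

namespace Summit.QuantumFields.YangMills.Cruxes.CurvatureUniformityR.Disproof

open Summit.QuantumFields.YangMills.Cruxes.CurvatureUniformityR.ConeTameSplit (ConeChartsOfAdmissible TameCoreUniformityR
  CurvatureUniformityR_of_subs)

/-! ## Targets -/

/-- **Target `stub_coneCharts` is false** (line `cone_tame_window_transfer`): the landed refutation, by name.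
Witness `X₈` = 8-subdivided `(hemicube ⊔ pillow)/(4 pinches)`, admissible at `k = 8`, `j = 0`, cone links `C₂ ⊔ C₃`.
(p173245, computational: `native_decide`.) -/
theorem stub_coneCharts_false : ¬ ConeChartsOfAdmissible :=
  Summit.QuantumFields.YangMills.Theorems.CurvatureUniformityR.Negative.coneChartsOfAdmissible_false

/-- What survives of the cone/tame cut after the kill: the crux follows from `TameCoreUniformityR` only together with the
(false) rigidity claim, i.e. the line must be RESTATED (cone charts as data), not repaired inside `ConeChartsOfAdmissible`. -/
theorem coneTame_cut_is_vacuous :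
    (TameCoreUniformityR → ConeChartsOfAdmissible →
      Summit.QuantumFields.YangMills.Theses.HyperbolicRegulator.CurvatureUniformityR) ∧ ¬ ConeChartsOfAdmissible :=
  ⟨CurvatureUniformityR_of_subs, stub_coneCharts_false⟩

/-! ## The reusable obstruction behind the kill (G-free, data-free) -/

/-- **Cone charts force a Hamiltonian 5-cycle in the link.**  Let `P` be the chart-point function of the cone-chart clause
`CC` (sector `s`, polar box coordinates `(a, b)`, `P c s 0 0 = c`, `P c s 0 b = cK c (s+1) (b, 0)`), and assume at the cone
`c` the three conjuncts of `CC` that are used: injectivity of `(s, a, b) ↦ cK c s (a, b)` on `1 ≤ a`, the radial adjacency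
`P c s a b ~ P c s (a+1) b`, and the chart squares.  Then `n s := cK c s (1, 0)` is an injective family of five neighbours of
`c`, and for every `s` some square of `Q` passes through `c`, `n s` and `n (s+1)`.  Consequently NO complex having a cone whose
"common square through `c`" relation on its neighbours lacks a Hamiltonian 5-cycle admits cone charts — this is how `X₈`
(links `C₂ ⊔ C₃` at the pinch points) kills `ConeChartsOfAdmissible`, and it kills every future stub of the same shape. -/
theorem cc_link_hamiltonian {Γ : SimpleGraph ℕ} {Q : Finset ℕ} {st : ℕ × Bool → ℕ} {bd : ℕ → Fin 4 → ℕ × Bool}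
    {R : ℕ} (hR : 2 ≤ R) (c : ℕ) (cK : ℕ → Fin 5 → ℕ × ℕ → ℕ) (P : ℕ → Fin 5 → ℕ → ℕ → ℕ)
    (hP : ∀ c' s a b, P c' s a b = if a = 0 ∧ b = 0 then c' else if a = 0 then cK c' (s + 1) (b, 0) else cK c' s (a, b))
    (h3 : ∀ (s s' : Fin 5) (a a' b b' : ℕ), 1 ≤ a → a ≤ R → b ≤ R → 1 ≤ a' → a' ≤ R → b' ≤ R →
      cK c s (a, b) = cK c s' (a', b') → s = s' ∧ a = a' ∧ b = b')
    (h4 : ∀ (s : Fin 5) (a b : ℕ), a + 1 ≤ R → b ≤ R → Γ.Adj (P c s a b) (P c s (a + 1) b))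
    (h6 : ∀ (s : Fin 5) (a b : ℕ), a + 1 ≤ R → b + 1 ≤ R → ∃ q ∈ Q,
      Finset.univ.image (st ∘ bd q) = {P c s a b, P c s (a + 1) b, P c s a (b + 1), P c s (a + 1) (b + 1)}) :
    Function.Injective (fun s : Fin 5 => cK c s (1, 0)) ∧ (∀ s : Fin 5, Γ.Adj c (cK c s (1, 0))) ∧
      ∀ s : Fin 5, ∃ q ∈ Q, c ∈ Finset.univ.image (st ∘ bd q) ∧ cK c s (1, 0) ∈ Finset.univ.image (st ∘ bd q) ∧
        cK c (s + 1) (1, 0) ∈ Finset.univ.image (st ∘ bd q) := by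
  have hP00 : ∀ s, P c s 0 0 = c := fun s => by simp [hP]
  have hP10 : ∀ s, P c s 1 0 = cK c s (1, 0) := fun s => by simp [hP]
  have hP01 : ∀ s, P c s 0 1 = cK c (s + 1) (1, 0) := fun s => by simp [hP]
  refine ⟨?_, ?_, ?_⟩
  · intro s s' hss
    exact (h3 s s' 1 1 0 0 le_rfl (by omega) (Nat.zero_le _) le_rfl (by omega) (Nat.zero_le _) hss).1
  · intro s
    have := h4 s 0 0 (by omega) (Nat.zero_le _)
    rwa [hP00, zero_add, hP10] at this
  · intro s
    obtain ⟨q, hq, himg⟩ := h6 s 0 0 (by omega) (by omega)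
    rw [hP00, zero_add, hP10, hP01] at himg
    refine ⟨q, hq, ?_, ?_, ?_⟩ <;> simp [himg]

/-- **Corollary (the kill pattern).**  If the neighbours of a cone `c` all lie in a set `nb` enumerated by `nbl : Fin 5 → ℕ`,
the squares through `c` only realise the ordered neighbour pairs `good`, and `good` carries no Hamiltonian 5-cycle, then the
three used conjuncts of `CC` cannot hold at `c` for ANY `cK`. (Instantiated by `X₈` in the landed file.) -/
theorem no_coneChart_of_no_hamiltonian {Γ : SimpleGraph ℕ} {Q : Finset ℕ} {st : ℕ × Bool → ℕ}
    {bd : ℕ → Fin 4 → ℕ × Bool} {R : ℕ} (hR : 2 ≤ R) (c : ℕ) (nb : Finset ℕ) (nbl : Fin 5 → ℕ) (good : Finset (ℕ × ℕ))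
    (hnb : ∀ v, Γ.Adj c v → v ∈ nb) (hnbl : ∀ v ∈ nb, ∃ i, nbl i = v)
    (hsq : ∀ q ∈ Q, ∀ u ∈ nb, ∀ v ∈ nb, u ≠ v → c ∈ Finset.univ.image (st ∘ bd q) →
      u ∈ Finset.univ.image (st ∘ bd q) → v ∈ Finset.univ.image (st ∘ bd q) → (u, v) ∈ good)
    (hham : ∀ g : Fin 5 → Fin 5, Function.Injective g → ¬ ∀ s : Fin 5, (nbl (g s), nbl (g (s + 1))) ∈ good)
    (cK : ℕ → Fin 5 → ℕ × ℕ → ℕ) (P : ℕ → Fin 5 → ℕ → ℕ → ℕ)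
    (hP : ∀ c' s a b, P c' s a b = if a = 0 ∧ b = 0 then c' else if a = 0 then cK c' (s + 1) (b, 0) else cK c' s (a, b))
    (h3 : ∀ (s s' : Fin 5) (a a' b b' : ℕ), 1 ≤ a → a ≤ R → b ≤ R → 1 ≤ a' → a' ≤ R → b' ≤ R →
      cK c s (a, b) = cK c s' (a', b') → s = s' ∧ a = a' ∧ b = b')
    (h4 : ∀ (s : Fin 5) (a b : ℕ), a + 1 ≤ R → b ≤ R → Γ.Adj (P c s a b) (P c s (a + 1) b))
    (h6 : ∀ (s : Fin 5) (a b : ℕ), a + 1 ≤ R → b + 1 ≤ R → ∃ q ∈ Q,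
      Finset.univ.image (st ∘ bd q) = {P c s a b, P c s (a + 1) b, P c s a (b + 1), P c s (a + 1) (b + 1)}) :
    False := by
  obtain ⟨hinj, hadj, hsqs⟩ := cc_link_hamiltonian hR c cK P hP h3 h4 h6
  have hmem : ∀ s : Fin 5, cK c s (1, 0) ∈ nb := fun s => hnb _ (hadj s)
  choose g hg using fun s => hnbl _ (hmem s)
  have ginj : Function.Injective g := fun s s' hss => hinj (by simp only; rw [← hg s, ← hg s', hss])
  have hne : ∀ s : Fin 5, s ≠ s + 1 := by decide
  refine hham g ginj fun s => ?_
  obtain ⟨q, hq, m0, m1, m2⟩ := hsqs s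
  have h := hsq q hq _ (hmem s) _ (hmem (s + 1)) (fun heq => hne s (hinj heq)) m0 m1 m2
  rwa [← hg s, ← hg (s + 1)] at h

end Summit.QuantumFields.YangMills.Cruxes.CurvatureUniformityR.Disproof
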